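import Mathlib.Analysis.Convex.PathConnected
import Literature.Topology.PlaneTopology.WindingNumberCrossing
import HarnessLib

/-!
# A winding-number certificate of separation: loops with a straight piece crossed once

Topic: Topology / PlaneTopology (companion to `WindingNumberCrossing.lean`). The elementary
separation criterion used to confine the region of the lattice sign-condition argument
(`Literature/Probability/LatticeModels/KCTouchReach.lean`, Chelkak–Smirnov 2012, proof of
Thm. 6.1: the part `D^δ` of `Ω^δ` "lying inside" the contour `C`) WITHOUT the Jordan curve
theorem and without simplicity of the loop:

* `StraightLoop q₁ q₂ γ` — the loop `[q₁, q₂] · γ` obtained by closing a path `γ : Path q₂ q₁`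
  with the straight segment from `q₁` to `q₂` (as a map `ℝ → ℂ`, the `Path.extend` of
  `(Path.segment q₁ q₂).trans γ`), its continuity, periodicity, straightness on `[0, ½]` and range;
* **`exists_mem_range_of_straightCross`** — if the short segment `[ℓ, r]` crosses the straight
  piece `[q₁, q₂]` (`q₁`, `q₂` strictly on opposite sides of the line `ℓ r`, the two segments
  meeting at an interior point of `[ℓ, r]`) and misses the closing path `γ`, if `z` is joined to
  `ℓ` and `r` to `w` by paths missing the loop, then EVERY path from `z` to `w` meets the loop:
  the winding numbers of the loop about `ℓ` and `r` differ by one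
  (`wind_sub_wind_of_straight_cross`), are transported to `z` and `w` along the two paths
  (`wind_affine_sub_eq_of_path`), and a path from `z` to `w` missing the loop would make them
  equal.

Everything is `[folklore]` (Ahlfors, *Complex Analysis* (1979), §4.2.1, Lemma 2: the winding
number is constant on complementary components and jumps by `±1` across an arc).

## References

* L. V. Ahlfors, *Complex Analysis*, 3rd ed., McGraw-Hill (1979), §4.2.1. [Ahlfors1979]
* D. Chelkak, S. Smirnov, Invent. Math. 189 (2012), proof of Thm. 6.1 (the region `D^δ`). [ChelkakSmirnov2012Ising]
-/

noncomputable section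

open Complex Set Filter Topology
open scoped Real unitInterval

namespace Literature.Topology.PlaneTopology

variable {q₁ q₂ : ℂ}

/-- **The loop closed by a straight piece**: the segment from `q₁` to `q₂` followed by the path
`γ` from `q₂` back to `q₁`, read as a map `ℝ → ℂ` (the `Path.extend` of the concatenation; on
`[0, ½]` it runs affinely along `[q₁, q₂]`). [folklore] -/
def straightLoop (q₁ q₂ : ℂ) (γ : Path q₂ q₁) : ℝ → ℂ := ((Path.segment q₁ q₂).trans γ).extend

/-- The loop is continuous. [folklore] -/
theorem continuous_straightLoop (γ : Path q₂ q₁) : Continuous (straightLoop q₁ q₂ γ) :=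
  Path.continuous_extend _

/-- The loop closes up: its values at `0` and `1` are both `q₁`. [folklore] -/
theorem straightLoop_zero_one (γ : Path q₂ q₁) : straightLoop q₁ q₂ γ 0 = q₁ ∧ straightLoop q₁ q₂ γ 1 = q₁ := by
  simp [straightLoop]

/-- At time `½` the loop is at `q₂`. [folklore] -/
theorem straightLoop_half (γ : Path q₂ q₁) : straightLoop q₁ q₂ γ (1 / 2) = q₂ := by
  have h : ((1 / 2 : ℝ)) ∈ Icc (0 : ℝ) 1 := ⟨by norm_num, by norm_num⟩
  rw [straightLoop, Path.extend_apply _ h, Path.trans_apply]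
  simp

/-- **Straightness on `[0, ½]`**: `L s = lineMap q₁ q₂ (2s)`. [folklore] -/
theorem straightLoop_of_le_half (γ : Path q₂ q₁) {s : ℝ} (hs : s ∈ Icc (0 : ℝ) (1 / 2)) :
    straightLoop q₁ q₂ γ s = AffineMap.lineMap q₁ q₂ (2 * s) := by
  have hs01 : s ∈ Icc (0 : ℝ) 1 := ⟨hs.1, hs.2.trans (by norm_num)⟩
  rw [straightLoop, Path.extend_apply _ hs01, Path.trans_apply, dif_pos (show ((⟨s, hs01⟩ : I) : ℝ) ≤ 1 / 2 from hs.2),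
    Path.segment_apply]

/-- On `[½, 1]` the loop runs along `γ`. [folklore] -/
theorem straightLoop_mem_range_of_half_le (γ : Path q₂ q₁) {s : ℝ} (hs : s ∈ Icc (1 / 2 : ℝ) 1) :
    straightLoop q₁ q₂ γ s ∈ range γ := by
  have hs01 : s ∈ Icc (0 : ℝ) 1 := ⟨le_trans (by norm_num) hs.1, hs.2⟩
  rw [straightLoop, Path.extend_apply _ hs01, Path.trans_apply]
  split_ifs with h
  · -- `s = ½`: the value is `q₂ = γ 0`
    have hs2 : s = 1 / 2 := le_antisymm h hs.1
    subst hs2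
    have : (⟨2 * (1 / 2 : ℝ), by norm_num⟩ : I) = 1 := Subtype.ext (by norm_num)
    simp only [this, Path.target]
    exact ⟨0, γ.source⟩
  · exact mem_range_self _

/-- **The range of the loop** is the straight piece together with the range of `γ`. [folklore] -/
theorem range_straightLoop_subset (γ : Path q₂ q₁) {s : ℝ} (hs : s ∈ Icc (0 : ℝ) 1) :
    straightLoop q₁ q₂ γ s ∈ segment ℝ q₁ q₂ ∪ range γ := by
  have := mem_range_self (f := (Path.segment q₁ q₂).trans γ) ⟨s, hs⟩
  rw [Path.trans_range, Path.range_segment] at this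
  rw [straightLoop, Path.extend_apply _ hs]
  exact this

/-- **The winding-number certificate of separation.** Let the loop `L = [q₁, q₂] · γ` be closed
by the straight piece `[q₁, q₂]`, and let the segment `[ℓ, r]` cross that piece — `q₁` strictly
on the positive and `q₂` strictly on the negative side of the line `ℓ r` (`segSide`), the two
segments meeting at an interior point of `[ℓ, r]` — while missing `γ`. If `z` is joined to `ℓ`
and `r` to `w` by paths missing the loop, then every path from `z` to `w` meets the loop (on
`[0, 1]`). [folklore] -/
theorem exists_mem_range_of_straightCross (γ : Path q₂ q₁) {ℓ r z w : ℂ}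
    (hA : 0 < segSide ℓ r q₁) (hB : segSide ℓ r q₂ < 0)
    (hx : ∃ p ∈ segment ℝ q₁ q₂, p ∈ openSegment ℝ ℓ r)
    (hγ : ∀ t, γ t ∉ segment ℝ ℓ r)
    (Pz : Path z ℓ) (hPz : ∀ t, ∀ s ∈ Icc (0 : ℝ) 1, Pz t ≠ straightLoop q₁ q₂ γ s)
    (Pw : Path r w) (hPw : ∀ t, ∀ s ∈ Icc (0 : ℝ) 1, Pw t ≠ straightLoop q₁ q₂ γ s)
    (β : Path z w) : ∃ t, ∃ s ∈ Icc (0 : ℝ) 1, β t = straightLoop q₁ q₂ γ s := by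
  have hLc : ContinuousOn (straightLoop q₁ q₂ γ) (Icc 0 1) := (continuous_straightLoop γ).continuousOn
  obtain ⟨h0, h1⟩ := straightLoop_zero_one γ
  have h01 : straightLoop q₁ q₂ γ 0 = straightLoop q₁ q₂ γ 1 := by rw [h0, h1]
  have hhalf := straightLoop_half γ
  -- images of paths missing the loop
  have himage : ∀ {x y : ℂ} (P : Path x y), (∀ t, ∀ s ∈ Icc (0 : ℝ) 1, P t ≠ straightLoop q₁ q₂ γ s) →
      ∀ t ∈ Icc (0 : ℝ) 1, P.extend t ∉ straightLoop q₁ q₂ γ '' Icc 0 1 := by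
    intro x y P hP t ht hmem
    obtain ⟨s, hs, hse⟩ := hmem
    rw [Path.extend_apply _ ht] at hse
    exact hP ⟨t, ht⟩ s hs hse.symm
  -- the winding number is transported along paths missing the loop
  have htrans : ∀ {x y : ℂ} (P : Path x y), (∀ t, ∀ s ∈ Icc (0 : ℝ) 1, P t ≠ straightLoop q₁ q₂ γ s) →
      wind (fun τ => straightLoop q₁ q₂ γ (0 + τ * (1 - 0)) - x) =
        wind (fun τ => straightLoop q₁ q₂ γ (0 + τ * (1 - 0)) - y) := by
    intro x y P hP
    simpa [Path.extend_zero, Path.extend_one] using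
      (wind_affine_sub_eq_of_path (le_of_lt zero_lt_one) hLc h01 zero_le_one P.continuous_extend.continuousOn (himage P hP))
  -- the jump across the straight piece
  have hjump : wind (fun τ => straightLoop q₁ q₂ γ (0 + τ * (1 - 0)) - ℓ) -
      wind (fun τ => straightLoop q₁ q₂ γ (0 + τ * (1 - 0)) - r) = 1 := by
    refine wind_sub_wind_of_straight_cross (u := 0) (u' := 1 / 2) le_rfl (by norm_num) (by norm_num) hLc h01 ?_ ?_ ?_ ?_ ?_
    · intro s hs
      rw [h0, hhalf, straightLoop_of_le_half γ hs]
      congr 1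
      ring
    · intro s hs
      rcases hs with hs | hs
      · have : s = 0 := le_antisymm hs.2 hs.1
        rw [this, h0]
        exact fun h => hA.ne' (segSide_eq_zero_of_mem_segment h)
      · obtain ⟨t, ht⟩ := straightLoop_mem_range_of_half_le γ hs
        rw [← ht]; exact hγ t
    · rw [h0]; exact hA
    · rw [hhalf]; exact hB
    · rw [h0, hhalf]; exact hx
  -- transport to `z` and `w`, and along a hypothetical path missing the loop
  by_contra hβ
  push Not at hβ
  have hz := htrans Pz hPz
  have hw := htrans Pw hPw
  have hzw := htrans β fun t s hs => hβ t s hs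
  omega

/-- **Set form of the certificate.** If moreover the straight piece lies in `S` and the closing
path `γ` in `S ∪ T`, then every path from `z` to `w` missing `T` meets `S` (used with `S` = the
contour and `T` = the frozen skeleton of the lattice sign-condition argument). [folklore] -/
theorem exists_mem_of_straightCross (γ : Path q₂ q₁) {ℓ r z w : ℂ} {S T : Set ℂ}
    (hA : 0 < segSide ℓ r q₁) (hB : segSide ℓ r q₂ < 0)
    (hx : ∃ p ∈ segment ℝ q₁ q₂, p ∈ openSegment ℝ ℓ r)
    (hγ : ∀ t, γ t ∉ segment ℝ ℓ r)
    (Pz : Path z ℓ) (hPz : ∀ t, ∀ s ∈ Icc (0 : ℝ) 1, Pz t ≠ straightLoop q₁ q₂ γ s)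
    (Pw : Path r w) (hPw : ∀ t, ∀ s ∈ Icc (0 : ℝ) 1, Pw t ≠ straightLoop q₁ q₂ γ s)
    (hseg : segment ℝ q₁ q₂ ⊆ S) (hγST : ∀ t, γ t ∈ S ∪ T)
    (β : Path z w) (hβT : ∀ t, β t ∉ T) : ∃ t, β t ∈ S := by
  obtain ⟨t, s, hs, hts⟩ := exists_mem_range_of_straightCross γ hA hB hx hγ Pz hPz Pw hPw β
  refine ⟨t, ?_⟩
  rcases range_straightLoop_subset γ hs with h | ⟨t', ht'⟩
  · rw [hts]; exact hseg h
  · rcases hγST t' with h' | h'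
    · rw [hts, ← ht']; exact h'
    · exact absurd (by rw [hts, ← ht']; exact h') (hβT t)

/-- Paths missing `S ∪ T` miss the loop (the form in which the two transport paths are checked). [folklore] -/
theorem ne_straightLoop_of_not_mem (γ : Path q₂ q₁) {S T : Set ℂ} (hseg : segment ℝ q₁ q₂ ⊆ S)
    (hγST : ∀ t, γ t ∈ S ∪ T) {x y : ℂ} (P : Path x y) (hP : ∀ t, P t ∉ S ∧ P t ∉ T) :
    ∀ t, ∀ s ∈ Icc (0 : ℝ) 1, P t ≠ straightLoop q₁ q₂ γ s := by
  intro t s hs h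
  rcases range_straightLoop_subset γ hs with h' | ⟨t', ht'⟩
  · exact (hP t).1 (h ▸ hseg h')
  · rcases hγST t' with h'' | h''
    · exact (hP t).1 (by rw [h, ← ht']; exact h'')
    · exact (hP t).2 (by rw [h, ← ht']; exact h'')

end Literature.Topology.PlaneTopology
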